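import Mathlib
import Summits.PneNP.PneNP.Theorems.ConvexRankGatesConvexGateBlindColumnSpaceBlind

/-!
# PneNP / ConvexRankGates — `ConvexGateBlind`: no polynomial negative covers (the ε-free necessary condition of the crux HOLDS)

Helpers (`--supports stmt-PneNP-10680`), COLUMN-SPACE line (prover seat 2, session 13) — closing the loop with
`…NegCover.lean` (s4). There, `negCoverHard_of_convexGateBlind` derived from the CRUX that eventually no NEGATIVE COVER of
size `≤ m^c` exists: no edge weightings `t_1,…,t_s` of `K_m`, non-negative on every `k`-set, such that every `k`-clique-free
graph `u` carries a conic combination `∑_j μ_j(u) t_j ≤ −1` on all of its edges. With the catch bound of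
`…NegCoverCatch.lean` this necessary condition of the crux is now a THEOREM, for every `δ ∈ (0, 1/11)` (the crux would give
it for its own `δ < 1/2`), and without the boundedness hypothesis `∑_j μ_j t_j ≤ Λ`:

* `negCover_size_lower_bound` — fixed `m` (`4 ≤ k`, `k + 2 ≤ m`): a negative cover of size `s` has
  `(k−1)^m − (k−1) ≤ s·(k−1)^m·exp(−1/(512L²√β))`;
* `negCoverHard` (stub `negCover_hard`) — for `δ ∈ (0,1/11)` and every `c`: eventually in `m`, no negative cover of size
  `≤ m^c` exists (stated with the hypotheses of `negCoverHard_of_convexGateBlind` verbatim, the bound `Λ` being unused).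
[new]
-/

set_option linter.dupNamespace false

namespace Summit.PneNP.PneNP.Theorems

open Finset Real Filter Literature.Computability.Complexity
open Summit.PneNP.PneNP.Cruxes.ConvexGateBlind.StrictRankConicCover (Edge cdist)

noncomputable section

/-- **Negative covers are large (fixed `m`).** For `4 ≤ k`, `k + 2 ≤ m`, `k`-clique-non-negative `t_1,…,t_s` and `μ ≥ 0` with
`∑_j μ_j(u) t_j ≤ −1` on the edges of every `k`-clique-free `u`: `(k−1)^m − (k−1) ≤ s·(k−1)^m·exp(−1/(512L²√β))`
(`L = 2k²−4k+1`, `β = C(k,2)(k−2)/(m−k)`). [new] -/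
theorem negCover_size_lower_bound {m k s : ℕ} (hk : 4 ≤ k) (hm : k + 2 ≤ m)
    (t : Fin s → Edge m → ℝ) (ht : ∀ j (Q : Finset (Fin m)), Q.card = k → 0 ≤ ∑ e, if cliqueVec Q e = true then t j e else 0)
    (μ : (Edge m → Bool) → Fin s → ℝ) (hμ : ∀ u j, 0 ≤ μ u j)
    (hcov : ∀ u, cliqueFn m k u = false → ∀ e, u e = true → ∑ j, μ u j * t j e ≤ -1) :
    ((k - 1 : ℕ) : ℝ) ^ m - ((k - 1 : ℕ) : ℝ) ≤ s * (((k - 1 : ℕ) : ℝ) ^ m *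
      Real.exp (-(1 / (512 * (2 * (k : ℝ) ^ 2 - 4 * k + 1) ^ 2 *
        Real.sqrt (((k : ℝ) * (k - 1) / 2) * ((k - 2) / (m - k))))))) := by
  classical
  set BAD : Fin s → Finset (Fin m → Fin (k - 1)) := fun j =>
    (Finset.univ : Finset (Fin m → Fin (k - 1))).filter fun c => ∑ e, (if colorVec c e = true then t j e else 0) < 0
    with hBAD
  -- every non-constant colouring is caught
  have hcover : ((Finset.univ : Finset (Fin m → Fin (k - 1))).filter fun c => ∃ x y, c x ≠ c y) ⊆
      (Finset.univ : Finset (Fin s)).biUnion BAD := by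
    intro c hc
    rw [Finset.mem_filter] at hc
    have hcf : cliqueFn m k (colorVec c) = false := cliqueFn_colorVec c (by omega)
    obtain ⟨j, hj⟩ := exists_neg_sum_of_negCover t (μ (colorVec c)) (hμ (colorVec c)) (colorVec c)
      (exists_colorVec_eq_true c hc.2) (hcov (colorVec c) hcf)
    exact Finset.mem_biUnion.2 ⟨j, Finset.mem_univ _, Finset.mem_filter.2 ⟨Finset.mem_univ _, hj⟩⟩
  -- each generator catches few colourings
  have hcatch : ∀ j : Fin s, ((BAD j).card : ℝ) ≤ ((k - 1 : ℕ) : ℝ) ^ m *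
      Real.exp (-(1 / (512 * (2 * (k : ℝ) ^ 2 - 4 * k + 1) ^ 2 *
        Real.sqrt (((k : ℝ) * (k - 1) / 2) * ((k - 2) / (m - k)))))) := by
    intro j
    refine card_badColourings_le hk hm (t j) fun Q hQ => ?_
    rw [← sum_ite_cliqueVec_eq_softWindow]
    exact ht j Q (Finset.mem_powersetCard.1 hQ).2
  have hnc := card_filter_nonconstant_ge (K := k - 1) (show 0 < m by omega)
  have h1 : (((Finset.univ : Finset (Fin m → Fin (k - 1))).filter fun c => ∃ x y, c x ≠ c y).card : ℝ) ≤
      ∑ j : Fin s, ((BAD j).card : ℝ) := by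
    have := (Finset.card_le_card hcover).trans Finset.card_biUnion_le
    exact_mod_cast this
  have h2 : ∑ j : Fin s, ((BAD j).card : ℝ) ≤ s * (((k - 1 : ℕ) : ℝ) ^ m *
      Real.exp (-(1 / (512 * (2 * (k : ℝ) ^ 2 - 4 * k + 1) ^ 2 *
        Real.sqrt (((k : ℝ) * (k - 1) / 2) * ((k - 2) / (m - k))))))) := by
    calc ∑ j : Fin s, ((BAD j).card : ℝ) ≤ ∑ _j : Fin s, ((k - 1 : ℕ) : ℝ) ^ m *
          Real.exp (-(1 / (512 * (2 * (k : ℝ) ^ 2 - 4 * k + 1) ^ 2 *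
            Real.sqrt (((k : ℝ) * (k - 1) / 2) * ((k - 2) / (m - k)))))) := Finset.sum_le_sum fun j _ => hcatch j
      _ = _ := by rw [Finset.sum_const, Finset.card_univ, Fintype.card_fin, nsmul_eq_mul]
  have h0 : (((k - 1 : ℕ) : ℝ)) ^ m ≤
      (((Finset.univ : Finset (Fin m → Fin (k - 1))).filter fun c => ∃ x y, c x ≠ c y).card : ℝ) + ((k - 1 : ℕ) : ℝ) := by
    exact_mod_cast hnc
  linarith

/-- **No polynomial negative covers (every `δ ∈ (0, 1/11)`, every `c`).** Eventually in `m` (`k = ⌈m^δ⌉₊`), for every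
`s ≤ m^c`, all `k`-clique-non-negative `t_1,…,t_s` and all `μ ≥ 0`: the family is NOT a negative cover — some `k`-clique-free
`u` has an edge `e` with `∑_j μ_j(u) t_j(e) > −1`. This is the conclusion of `negCoverHard_of_convexGateBlind` (there derived
from the crux), now unconditional; the hypotheses `0 ≤ Λ`, `∑_j μ_j t_j ≤ Λ` are kept for comparability and not used. [new] -/
theorem negCoverHard {δ : ℝ} (hδ0 : 0 < δ) (hδ1 : δ < 1 / 11) :
    ∀ c : ℕ, ∀ᶠ m : ℕ in atTop, ∀ s : ℕ, s ≤ m ^ c →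
      ∀ (t : Fin s → Edge m → ℝ) (μ : (Edge m → Bool) → Fin s → ℝ) (Λ : ℝ),
        (∀ j (Q : Finset (Fin m)), Q.card = ⌈(m : ℝ) ^ δ⌉₊ → 0 ≤ ∑ e, if cliqueVec Q e = true then t j e else 0) →
        (∀ u j, 0 ≤ μ u j) → 0 ≤ Λ →
        (∀ u, cliqueFn m ⌈(m : ℝ) ^ δ⌉₊ u = false → ∀ e, ∑ j, μ u j * t j e ≤ Λ) →
        ¬ ∀ u, cliqueFn m ⌈(m : ℝ) ^ δ⌉₊ u = false → ∀ e, u e = true → ∑ j, μ u j * t j e ≤ -1 := by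
  intro c
  filter_upwards [eventually_catch_exponent hδ0 hδ1 c] with m hm
  obtain ⟨hk4, hkm, hsmall⟩ := hm
  intro s hs t μ Λ ht hμ _ _ hcov
  set k : ℕ := ⌈(m : ℝ) ^ δ⌉₊ with hk
  have hkm2 : k + 2 ≤ m := by omega
  have hlb := negCover_size_lower_bound hk4 hkm2 t ht μ hμ hcov
  set θ : ℝ := Real.exp (-(1 / (512 * (2 * (k : ℝ) ^ 2 - 4 * k + 1) ^ 2 *
    Real.sqrt (((k : ℝ) * (k - 1) / 2) * ((k - 2) / (m - k)))))) with hθ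
  have hθ0 : 0 < θ := Real.exp_pos _
  have hq3 : (3 : ℝ) ≤ ((k - 1 : ℕ) : ℝ) := by
    have : 3 ≤ k - 1 := by omega
    exact_mod_cast this
  set qm : ℝ := ((k - 1 : ℕ) : ℝ) ^ m with hqm
  have hqm0 : 0 < qm := by rw [hqm]; positivity
  have hq_le : ((k - 1 : ℕ) : ℝ) ≤ qm / 2 := by
    obtain ⟨m', hm'⟩ : ∃ m', m = m' + 2 := ⟨m - 2, by omega⟩
    rw [hqm, hm', pow_succ, pow_succ]
    have h1 : (1 : ℝ) ≤ ((k - 1 : ℕ) : ℝ) ^ m' := one_le_pow₀ (by linarith)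
    have hQ0 : (0 : ℝ) ≤ ((k - 1 : ℕ) : ℝ) := by positivity
    have h2 := mul_le_mul h1 hq3 (by norm_num) (by positivity)
    have h3 := mul_le_mul_of_nonneg_right h2 hQ0
    linarith
  have hsθ : (s : ℝ) * (qm * θ) ≤ qm / 4 := by
    have hs' : (s : ℝ) ≤ (m : ℝ) ^ c := by exact_mod_cast hs
    calc (s : ℝ) * (qm * θ) ≤ (m : ℝ) ^ c * (qm * θ) := mul_le_mul_of_nonneg_right hs' (by positivity)
      _ = qm * ((m : ℝ) ^ c * θ) := by ring
      _ ≤ qm * (1 / 4) := mul_le_mul_of_nonneg_left hsmall hqm0.le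
      _ = qm / 4 := by ring
  linarith

/-- **No polynomial negative covers** (registered form of `negCoverHard`). [new] -/
theorem negCover_hard : ∀ (δ : ℝ), 0 < δ → δ < 1 / 11 → ∀ c : ℕ, ∀ᶠ m : ℕ in Filter.atTop, ∀ s : ℕ, s ≤ m ^ c → ∀ (t : Fin s → Edge m → ℝ) (μ : (Edge m → Bool) → Fin s → ℝ) (Λ : ℝ), (∀ j (Q : Finset (Fin m)), Q.card = ⌈(m : ℝ) ^ δ⌉₊ → 0 ≤ ∑ e, if cliqueVec Q e = true then t j e else 0) → (∀ u j, 0 ≤ μ u j) → 0 ≤ Λ → (∀ u, cliqueFn m ⌈(m : ℝ) ^ δ⌉₊ u = false → ∀ e, ∑ j, μ u j * t j e ≤ Λ) → ¬ ∀ u, cliqueFn m ⌈(m : ℝ) ^ δ⌉₊ u = false → ∀ e, u e = true → ∑ j, μ u j * t j e ≤ -1 :=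
  fun _ hδ0 hδ1 c => negCoverHard hδ0 hδ1 c

end

end Summit.PneNP.PneNP.Theorems
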